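import Summits.QuantumFields.BalabanUV.Beta.FP.KernelWardBoundedBricks
import Summits.QuantumFields.BalabanUV.Beta.TameKernelCalculus

/-!
# `BalabanUV.Beta.FP.ChartConjugationBoundedBricks` — road «FP», binder row D1, sub-row **H2-ASM-5a (Kcov)**, module R6 part 1∕2: THE ABSOLUTELY
# CONVERGENT RE-ASSOCIATIONS, TRACE CYCLICITY AND SLOT ADDITIVITY FOR A **BOUNDED** LEG against spread chart inverses and localised letters — the
# Fubini bricks an5's `ChartConjugation(Relative)` takes from `TameKernelCalculus` (`Tame` leg: summable rows AND columns), re-instanced for a leg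
# that is merely `KernelWard.Bdd` (the perfect leg `Pker` of `PiBF` is power-law, not `Tame`)

HONEST DEPENDENCY (page 1, mandatory): continuum YM on T⁴ ⇐ BetaPertH ∧ nine spine estimates (0/9 proved); BetaPertH ⇐ (D1) ∧ (D4) ∧ CAP+tail;
G-an2-4 gates asym, D1 and NE2/3/4.  HONEST FRAMING (cell contract, verbatim): «discharging `BetaPertH` makes Bałaban's UV stability UNCONDITIONAL —
a real constructive-QFT result; it is NOT the continuum limit and NOT the Clay problem.»  THIS MODULE DISCHARGES NOTHING of the wall: [folklore] absolutely
convergent rearrangements of lattice-kernel compositions over an2's leg-agnostic bricks (`KernelWard.comp_assoc_of_bound`, `tr_comp_comm_of_bound`,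
`comp_sub_left∕right`, `tr_sub`), the BF-x road's right-localised bounds (`D1BFx.ContactCount`) and W1's `KernelWardBoundedBricks`, in an5's existential
currency `TameKernelCalculus.Spr ∕ Loc` for everything except the leg; 0 def, 0 `def … : Prop`, nothing cited, 0 sorry; 0∕4 row-D1 binders; NOT the (Kcov)
instance, NOT H2V-4, NOT D1, NOT BetaPertH, NOT continuum, NOT Clay.
ABSOLUTE RULE (cell charter, verbatim): «No internally-minted statement may enter as a cited fact. Every hypothesis is either kernel-proved in this package or a
verbatim quotation of a PUBLISHED theorem with page reference. The manuscript(s) under audit are NOT citable for their own disputed steps — they are the thing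
under adjudication; programme-internal (2001/route/tribunal) claims are never citable.»
THE CLASSES: leg `A` with `Bdd A C` only; chart inverse ∕ projector `M, E` SPREAD (`Spr`); generators and vertices LOCALISED (`Loc`).  `A∘K` is only
RIGHT-localised and `K∘A` only LEFT-localised; every series below still converges absolutely because each product carries a localised factor in the right
place — product majorants after one triangle inequality `|y−p|₁ ≤ |y−z|₁ + |z−p|₁` at half the common rate (`exp_triangle_le`).
CONTENT: §1 bounds of composites (`rl_comp_bdd_loc`, `lr_comp_loc_bdd`, `bdd_comp_bdd_loc ∕ _loc_bdd`, `abs_comp_le_of_rightLoc_rates`); §2 slice ∕ trace-series summability;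
§3 ASSOCIATIVITY `comp_assoc_bdd_loc_bdd` (Bdd, Loc, Bdd), `comp_assoc_bdd_spr_loc` (Bdd, Spr, Loc), `comp_assoc_rl_spr_bdd` (right-loc, Spr, Bdd) + corollaries,
`comp_assoc_rl_bdd_loc'` (right-loc, Bdd, Loc) + corollaries; §4 TRACE CYCLICITY `tr_comp_comm_loc_bdd`, `tr_comp_comm_rl_rl`, `tr_comp_comm_bddloc_bddloc`;
§5 ADDITIVITY `comp_add_right' ∕ _left'`, `tr_add'`, `tadpole_add_bdd ∕ _sub_bdd`, `bubble_add_left_bdd ∕ _right_bdd`.  Consumer: R6 part 2 `FP/ChartConjugationBounded`.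
Provenance: D1 formalisation swarm seat b2b-balaban-beta-d1-formalise-leaf-02 gen 10 (road FP engine lineage; sub-row H2-ASM-5a (Kcov)), 2026-08-21.
-/

noncomputable section

namespace Summit.QuantumFields.BalabanUV.Beta.FP.ChartConjugationBoundedBricks

open Finset
open scoped BigOperators
open Literature.MathematicalPhysics.QuantumFieldTheory.Balaban1983to89
open Literature.MathematicalPhysics.QuantumFieldTheory.Balaban1983to89.Beta
open B12Sec2to5 (l1 l1_nonneg)
open ExpKernelCalculus (MKer Decays BiLoc comp tr bubble tadpole Zl Zl_nonneg summable_exp_shift summable_exp_shift' tsum_exp_shift'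
  l1_sub_triangle)
open KernelWard (Bdd bdd_of_biLoc bdd_of_decays slices_bdd_biLoc slices_biLoc_bdd comp_sub_right comp_sub_left tr_sub comp_assoc_of_bound
  tr_comp_comm_of_bound)
open OneStepKernelFamily (l1_neg_eq)
open Summit.QuantumFields.BalabanUV.Beta.TameKernelCalculus (Spr Loc biLoc_of_le trK trK_apply trK_trK trK_comp Loc.trK Spr.trK)
open Summit.QuantumFields.BalabanUV.Beta.D1BFx.ContactCount (abs_comp_le_of_entryBound abs_comp_le_of_rightLoc abs_trTerm_le_of_rightLoc)
open Summit.QuantumFields.BalabanUV.Beta.FP.KernelWardBoundedBricks (rl_of_biLoc bdd_of_rl summable_trTerm_rl slices_rl_bdd comp_assoc_rl_bdd_biLoc)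

variable {D : ℕ} {F : Type*} [Fintype F]

/-! ## §1 Bounds of composites -/

section Bounds

variable {A K L P : MKer D F} {B C Kp δ : ℝ} {q : Fin D → ℤ}

omit [Fintype F] in
/-- [folklore] a spread kernel is bounded. -/
theorem Spr.bdd' (hA : Spr A) : ∃ B, Bdd A B := let ⟨C, _, hδ, h⟩ := hA; ⟨C, bdd_of_decays h hδ.le⟩

omit [Fintype F] in
/-- [folklore] a localised kernel is bounded. -/
theorem Loc.bdd' (hK : Loc K) : ∃ B, Bdd K B := let ⟨_, _, C, _, hδ, h⟩ := hK; ⟨C, bdd_of_biLoc h hδ.le⟩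

omit [Fintype F] in
/-- [folklore] a localised kernel is right-localised (with a nonnegative constant and a positive rate). -/
theorem Loc.rl (hK : Loc K) :
    ∃ (q : Fin D → ℤ) (Kp δ : ℝ), 0 < δ ∧ 0 ≤ Kp ∧ ∀ x y a b, |K x y a b| ≤ Kp * Real.exp (-δ * l1 (y - q)) := by
  obtain ⟨p, q, C, δ, hδ, h⟩ := hK
  refine ⟨q, |C|, δ, hδ, abs_nonneg C, fun x y a b => (rl_of_biLoc h hδ.le x y a b).trans ?_⟩
  exact mul_le_mul_of_nonneg_right (le_abs_self C) (Real.exp_pos _).le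

/-- [folklore] **`A∘K` IS RIGHT-LOCALISED** for a bounded leg `A` and a localised `K`. -/
theorem rl_comp_bdd_loc (hA : Bdd A C) (hK : Loc K) :
    ∃ (q : Fin D → ℤ) (Kp δ : ℝ), 0 < δ ∧ 0 ≤ Kp ∧ ∀ x y a b, |comp A K x y a b| ≤ Kp * Real.exp (-δ * l1 (y - q)) := by
  obtain ⟨p, q, Ck, δ, hδ, hK⟩ := hK
  by_cases hF : Nonempty F
  · obtain ⟨a₀⟩ := hF
    have hC : 0 ≤ C := (abs_nonneg _).trans (hA p p a₀ a₀)
    exact ⟨q, (Fintype.card F : ℝ) * (C * Ck) * Zl D δ, δ, hδ,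
      mul_nonneg (mul_nonneg (Nat.cast_nonneg _) (mul_nonneg hC (hK.nonneg a₀))) (Zl_nonneg hδ),
      fun x y a b => abs_comp_le_of_entryBound hC hA hK hδ x y a b⟩
  · have hE : IsEmpty F := not_nonempty_iff.mp hF
    exact ⟨q, 0, δ, hδ, le_rfl, fun x y a b => (hE.false a).elim⟩

/-- [folklore] `A∘K` is bounded for a bounded leg and a localised `K`. -/
theorem bdd_comp_bdd_loc (hA : Bdd A C) (hK : Loc K) : ∃ B, Bdd (comp A K) B := by
  obtain ⟨q, Kp, δ, hδ, _, h⟩ := rl_comp_bdd_loc hA hK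
  exact ⟨Kp, bdd_of_rl h hδ.le⟩

/-- [folklore] **`K∘A` IS LEFT-LOCALISED** for a localised `K` and a bounded leg `A` (by transposition: `(K∘A)ᵀ = Aᵀ∘Kᵀ`). -/
theorem lr_comp_loc_bdd (hK : Loc K) (hA : Bdd A C) :
    ∃ (p : Fin D → ℤ) (Kp δ : ℝ), 0 < δ ∧ 0 ≤ Kp ∧ ∀ x y a b, |comp K A x y a b| ≤ Kp * Real.exp (-δ * l1 (x - p)) := by
  have hAt : Bdd (trK A) C := fun x y a b => hA y x b a
  obtain ⟨p, Kp, δ, hδ, hKp, h⟩ := rl_comp_bdd_loc hAt hK.trK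
  refine ⟨p, Kp, δ, hδ, hKp, fun x y a b => ?_⟩
  have e : comp K A x y a b = comp (trK A) (trK K) y x b a := by
    rw [← trK_apply (comp (trK A) (trK K)) x y a b, ← trK_comp, trK_trK]
  rw [e]
  exact h y x b a

/-- [folklore] `K∘A` is bounded for a localised `K` and a bounded leg. -/
theorem bdd_comp_loc_bdd (hK : Loc K) (hA : Bdd A C) : ∃ B, Bdd (comp K A) B := by
  obtain ⟨B, h⟩ := bdd_comp_bdd_loc (show Bdd (trK A) C from fun x y a b => hA y x b a) hK.trK
  exact ⟨B, fun x y a b => by rw [← trK_trK (comp K A), trK_comp, trK_apply]; exact h y x b a⟩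

/-- [folklore] right-localised ∘ right-localised is right-localised, at the minimum of the two rates. -/
theorem abs_comp_le_of_rightLoc_rates {P Q : MKer D F} {K₁ K₂ δ δ' : ℝ} {p q : Fin D → ℤ}
    (hP : ∀ x y a b, |P x y a b| ≤ K₁ * Real.exp (-δ * l1 (y - p))) (hδ : 0 < δ)
    (hQ : ∀ y z a b, |Q y z a b| ≤ K₂ * Real.exp (-δ' * l1 (z - q))) (hδ' : 0 < δ') (x z : Fin D → ℤ) (a b : F) :
    |comp P Q x z a b| ≤ (Fintype.card F : ℝ) * (K₁ * K₂) * Zl D (min δ δ') * Real.exp (-(min δ δ') * l1 (z - q)) := by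
  have hK₁ : 0 ≤ K₁ := nonneg_of_mul_nonneg_left ((abs_nonneg _).trans (hP x x a a)) (Real.exp_pos _)
  have hK₂ : 0 ≤ K₂ := nonneg_of_mul_nonneg_left ((abs_nonneg _).trans (hQ x x a a)) (Real.exp_pos _)
  have hm : 0 < min δ δ' := lt_min hδ hδ'
  have hP' : ∀ x y a b, |P x y a b| ≤ K₁ * Real.exp (-(min δ δ') * l1 (y - p)) := fun x y a b =>
    (hP x y a b).trans (mul_le_mul_of_nonneg_left (Real.exp_le_exp.mpr (by nlinarith [l1_nonneg (y - p), min_le_left δ δ'])) hK₁)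
  have hQ' : ∀ y z a b, |Q y z a b| ≤ K₂ * Real.exp (-(min δ δ') * l1 (z - q)) := fun y z a b =>
    (hQ y z a b).trans (mul_le_mul_of_nonneg_left (Real.exp_le_exp.mpr (by nlinarith [l1_nonneg (z - q), min_le_right δ δ'])) hK₂)
  exact abs_comp_le_of_rightLoc hP' hQ' hm x z a b

end Bounds

/-! ## §2 Summability of middle-leg slices and of trace series -/

section Summability

variable {A K L : MKer D F} {B C : ℝ}

/-- [folklore] slices of `A∘K`, bounded ∘ localised. -/
theorem slices_bdd_loc (hA : Bdd A C) (hK : Loc K) (x z : Fin D → ℤ) (a b : F) :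
    Summable fun y : Fin D → ℤ => ∑ f, A x y a f * K y z f b := by
  obtain ⟨p, q, Ck, δ, hδ, hK⟩ := hK
  exact slices_bdd_biLoc hA hK hδ x z a b

/-- [folklore] slices of `K∘A`, localised ∘ bounded. -/
theorem slices_loc_bdd (hK : Loc K) (hA : Bdd A C) (x z : Fin D → ℤ) (a b : F) :
    Summable fun y : Fin D → ℤ => ∑ f, K x y a f * A y z f b := by
  obtain ⟨p, q, Ck, δ, hδ, hK⟩ := hK
  exact slices_biLoc_bdd hK hA hδ x z a b

/-- [folklore] the trace series of `A∘K` (bounded ∘ localised) converges absolutely. -/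
theorem summable_tr_bdd_loc (hA : Bdd A C) (hK : Loc K) : Summable fun x : Fin D → ℤ => ∑ a, comp A K x x a a := by
  obtain ⟨q, Kp, δ, hδ, _, h⟩ := rl_comp_bdd_loc hA hK
  exact summable_trTerm_rl h hδ

/-- [folklore] the trace series of `K∘L` (localised ∘ bounded) converges absolutely. -/
theorem summable_tr_loc_bdd (hK : Loc K) (hL : Bdd L B) : Summable fun x : Fin D → ℤ => ∑ a, comp K L x x a a := by
  classical
  obtain ⟨p, Kp, δ, hδ, _, h⟩ := lr_comp_loc_bdd hK hL
  refine Summable.of_norm_bounded ((summable_exp_shift' hδ p).mul_left ((Fintype.card F : ℝ) * Kp)) fun x => ?_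
  rw [Real.norm_eq_abs]
  calc |∑ a, comp K L x x a a| ≤ ∑ a, |comp K L x x a a| := Finset.abs_sum_le_sum_abs _ _
    _ ≤ ∑ _a : F, Kp * Real.exp (-δ * l1 (x - p)) := Finset.sum_le_sum fun a _ => h x x a a
    _ = (Fintype.card F : ℝ) * Kp * Real.exp (-δ * l1 (x - p)) := by rw [Finset.sum_const, Finset.card_univ, nsmul_eq_mul]; ring

end Summability

/-! ## §3 Associativity -/

section Assoc

variable {A K L M P : MKer D F} {B C Kp δ : ℝ} {q : Fin D → ℤ}

/-- [folklore] **ASSOCIATIVITY (Bdd, Loc, Bdd)**: the localised middle factor majorises both sums. -/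
theorem comp_assoc_bdd_loc_bdd (hA : Bdd A C) (hK : Loc K) (hL : Bdd L B) : comp A (comp K L) = comp (comp A K) L := by
  obtain ⟨p, q, Ck, δ, hδ, hK⟩ := hK
  refine comp_assoc_of_bound fun x w a b => ?_
  have hC : 0 ≤ C := (abs_nonneg _).trans (hA x w a b)
  have hB : 0 ≤ B := (abs_nonneg _).trans (hL x w a b)
  have hCk : 0 ≤ Ck := hK.nonneg a
  refine ⟨fun y => C * Ck * Real.exp (-δ * l1 (y - p)), fun z => Real.exp (-δ * l1 (z - q)) * B,
    (summable_exp_shift' hδ p).mul_left _, (summable_exp_shift' hδ q).mul_right _, fun y => by positivity, fun z => by positivity,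
    fun y z f g => ?_⟩
  have h1 : |A x y a f| ≤ C := hA x y a f
  have h2 : |K y z f g| ≤ Ck * Real.exp (-δ * l1 (y - p)) * Real.exp (-δ * l1 (z - q)) := by
    have := hK y z f g
    rwa [show -δ * (l1 (y - p) + l1 (z - q)) = -δ * l1 (y - p) + -δ * l1 (z - q) by ring, Real.exp_add, ← mul_assoc] at this
  have h3 : |L z w g b| ≤ B := hL z w g b
  rw [abs_mul, abs_mul]
  calc |A x y a f| * |K y z f g| * |L z w g b| ≤ C * (Ck * Real.exp (-δ * l1 (y - p)) * Real.exp (-δ * l1 (z - q))) * B :=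
        mul_le_mul (mul_le_mul h1 h2 (abs_nonneg _) hC) h3 (abs_nonneg _) (by positivity)
    _ = C * Ck * Real.exp (-δ * l1 (y - p)) * (Real.exp (-δ * l1 (z - q)) * B) := by ring

/-- [folklore] the triangle step of the two mixed majorants: for `0 ≤ m`,
`−m·a − m·b ≤ −(m/2)·c − (m/2)·b` whenever `c ≤ a + b`, `0 ≤ a` (exponentiated). -/
theorem exp_triangle_le {m a b c : ℝ} (hm : 0 ≤ m) (ha : 0 ≤ a) (hc : c ≤ a + b) :
    Real.exp (-m * a) * Real.exp (-m * b) ≤ Real.exp (-(m / 2) * c) * Real.exp (-(m / 2) * b) := by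
  rw [← Real.exp_add, ← Real.exp_add, Real.exp_le_exp]
  nlinarith [mul_nonneg hm ha, mul_le_mul_of_nonneg_left hc hm]

/-- [folklore] **ASSOCIATIVITY (right-loc, Spr, Bdd)**: `P∘(M∘L) = (P∘M)∘L` for `P` right-localised, `M` spread, `L` bounded. -/
theorem comp_assoc_rl_spr_bdd (hP : ∀ x y a b, |P x y a b| ≤ Kp * Real.exp (-δ * l1 (y - q))) (hδ : 0 < δ) (hKp : 0 ≤ Kp)
    (hM : Spr M) (hL : Bdd L B) : comp P (comp M L) = comp (comp P M) L := by
  obtain ⟨CM, η, hη, hM⟩ := hM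
  set m : ℝ := min η δ with hm
  have hm0 : 0 < m := lt_min hη hδ
  have hmη : m ≤ η := min_le_left _ _
  have hmδ : m ≤ δ := min_le_right _ _
  refine comp_assoc_of_bound fun x w a b => ?_
  have hB : 0 ≤ B := (abs_nonneg _).trans (hL x w a b)
  have hCM : 0 ≤ CM := hM.nonneg a
  have hm2 : 0 < m / 2 := by linarith
  refine ⟨fun y => Kp * CM * B * Real.exp (-(m / 2) * l1 (y - q)), fun z => Real.exp (-(m / 2) * l1 (z - q)),
    (summable_exp_shift' hm2 q).mul_left _, summable_exp_shift' hm2 q, fun y => by positivity, fun z => by positivity,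
    fun y z f g => ?_⟩
  have h1 : |P x y a f| ≤ Kp * Real.exp (-m * l1 (y - q)) := by
    refine (hP x y a f).trans (mul_le_mul_of_nonneg_left (Real.exp_le_exp.mpr ?_) hKp)
    nlinarith [l1_nonneg (y - q)]
  have h2 : |M y z f g| ≤ CM * Real.exp (-m * l1 (z - y)) := by
    refine (hM y z f g).trans (mul_le_mul_of_nonneg_left (Real.exp_le_exp.mpr ?_) hCM)
    rw [← l1_neg_eq (y - z), neg_sub]
    nlinarith [l1_nonneg (z - y)]
  have h3 : |L z w g b| ≤ B := hL z w g b
  have htri : Real.exp (-m * l1 (z - y)) * Real.exp (-m * l1 (y - q)) ≤ Real.exp (-(m / 2) * l1 (z - q)) * Real.exp (-(m / 2) * l1 (y - q)) :=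
    exp_triangle_le hm0.le (l1_nonneg _) (l1_sub_triangle z y q)
  rw [abs_mul, abs_mul]
  calc |P x y a f| * |M y z f g| * |L z w g b| ≤ (Kp * Real.exp (-m * l1 (y - q))) * (CM * Real.exp (-m * l1 (z - y))) * B :=
        mul_le_mul (mul_le_mul h1 h2 (abs_nonneg _) (by positivity)) h3 (abs_nonneg _) (by positivity)
    _ = Kp * CM * B * (Real.exp (-m * l1 (z - y)) * Real.exp (-m * l1 (y - q))) := by ring
    _ ≤ Kp * CM * B * (Real.exp (-(m / 2) * l1 (z - q)) * Real.exp (-(m / 2) * l1 (y - q))) :=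
        mul_le_mul_of_nonneg_left htri (by positivity)
    _ = Kp * CM * B * Real.exp (-(m / 2) * l1 (y - q)) * Real.exp (-(m / 2) * l1 (z - q)) := by ring

/-- [folklore] associativity (Loc, Spr, Bdd). -/
theorem comp_assoc_loc_spr_bdd (hK : Loc K) (hM : Spr M) (hL : Bdd L B) : comp K (comp M L) = comp (comp K M) L := by
  obtain ⟨q, Kp, δ, hδ, hKp, h⟩ := Loc.rl hK
  exact comp_assoc_rl_spr_bdd h hδ hKp hM hL

/-- [folklore] **ASSOCIATIVITY (Bdd, Spr, Loc)**: `A∘(M∘K) = (A∘M)∘K` (the transpose of `comp_assoc_loc_spr_bdd`). -/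
theorem comp_assoc_bdd_spr_loc (hA : Bdd A C) (hM : Spr M) (hK : Loc K) : comp A (comp M K) = comp (comp A M) K := by
  have h := congrArg trK (comp_assoc_loc_spr_bdd hK.trK hM.trK (show Bdd (trK A) C from fun x y a b => hA y x b a))
  simp only [trK_comp, trK_trK] at h
  exact h.symm

/-- [folklore] associativity ((Bdd∘Loc), Spr, Bdd): `(A∘K)∘(M∘L) = ((A∘K)∘M)∘L`. -/
theorem comp_assoc_bddloc_spr_bdd (hA : Bdd A C) (hK : Loc K) (hM : Spr M) (hL : Bdd L B) :
    comp (comp A K) (comp M L) = comp (comp (comp A K) M) L := by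
  obtain ⟨q, Kp, δ, hδ, hKp, h⟩ := rl_comp_bdd_loc hA hK
  exact comp_assoc_rl_spr_bdd h hδ hKp hM hL

/-- [folklore] associativity (right-loc, Bdd, Loc) — W1's `comp_assoc_rl_bdd_biLoc` after lowering to a common rate. -/
theorem comp_assoc_rl_bdd_loc' (hP : ∀ x y a b, |P x y a b| ≤ Kp * Real.exp (-δ * l1 (y - q))) (hδ : 0 < δ) (hKp : 0 ≤ Kp)
    (hA : Bdd A C) (hL : Loc L) : comp P (comp A L) = comp (comp P A) L := by
  obtain ⟨p', q', Cl, δ₂, hδ₂, hL⟩ := hL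
  set m : ℝ := min δ δ₂ with hm
  have hm0 : 0 < m := lt_min hδ hδ₂
  have hP' : ∀ x y a b, |P x y a b| ≤ Kp * Real.exp (-m * l1 (y - q)) := fun x y a b =>
    (hP x y a b).trans (mul_le_mul_of_nonneg_left (Real.exp_le_exp.mpr (by nlinarith [l1_nonneg (y - q), min_le_left δ δ₂])) hKp)
  have hL' := biLoc_of_le hL (min_le_right δ δ₂)
  exact comp_assoc_rl_bdd_biLoc hP' hA hL' hm0

/-- [folklore] associativity (Loc, Bdd, Loc). -/
theorem comp_assoc_loc_bdd_loc (hK : Loc K) (hA : Bdd A C) (hL : Loc L) : comp K (comp A L) = comp (comp K A) L := by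
  obtain ⟨q, Kp, δ, hδ, hKp, h⟩ := Loc.rl hK
  exact comp_assoc_rl_bdd_loc' h hδ hKp hA hL

/-- [folklore] associativity ((Bdd∘Loc), Bdd, Loc): `(A∘K)∘(A′∘L) = ((A∘K)∘A′)∘L`. -/
theorem comp_assoc_bddloc_bdd_loc {A' : MKer D F} {C' : ℝ} (hA : Bdd A C) (hK : Loc K) (hA' : Bdd A' C') (hL : Loc L) :
    comp (comp A K) (comp A' L) = comp (comp (comp A K) A') L := by
  obtain ⟨q, Kp, δ, hδ, hKp, h⟩ := rl_comp_bdd_loc hA hK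
  exact comp_assoc_rl_bdd_loc' h hδ hKp hA' hL

end Assoc

/-! ## §4 Trace cyclicity -/

section Trace

variable {K L : MKer D F} {B Kp Kl δ₁ δ₂ : ℝ} {q q' : Fin D → ℤ}

/-- [folklore] **CYCLICITY (Loc, Bdd)**: `tr (K∘L) = tr (L∘K)` for `K` localised and `L` bounded (an5's `tr_comp_comm_loc` uses only the bound of `L`). -/
theorem tr_comp_comm_loc_bdd (hK : Loc K) (hL : Bdd L B) : tr (comp K L) = tr (comp L K) := by
  obtain ⟨p, q, C, δ, hδ, hK⟩ := hK
  by_cases hF : Nonempty F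
  · obtain ⟨a₀⟩ := hF
    have hB0 : 0 ≤ B := (abs_nonneg _).trans (hL p p a₀ a₀)
    have hC : 0 ≤ C := hK.nonneg a₀
    refine tr_comp_comm_of_bound ⟨fun x => C * B * Real.exp (-δ * l1 (x - p)), fun y => Real.exp (-δ * l1 (y - q)),
      (summable_exp_shift' hδ p).mul_left _, summable_exp_shift' hδ q, fun x => by positivity, fun y => by positivity,
      fun x y a f => ?_⟩
    have h1 : |K x y a f| ≤ C * Real.exp (-δ * l1 (x - p)) * Real.exp (-δ * l1 (y - q)) := by
      have := hK x y a f
      rwa [show -δ * (l1 (x - p) + l1 (y - q)) = -δ * l1 (x - p) + -δ * l1 (y - q) by ring, Real.exp_add, ← mul_assoc] at this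
    rw [abs_mul]
    calc |K x y a f| * |L y x f a| ≤ (C * Real.exp (-δ * l1 (x - p)) * Real.exp (-δ * l1 (y - q))) * B :=
          mul_le_mul h1 (hL y x f a) (abs_nonneg _) (by positivity)
      _ = C * B * Real.exp (-δ * l1 (x - p)) * Real.exp (-δ * l1 (y - q)) := by ring
  · have hE : IsEmpty F := not_nonempty_iff.mp hF
    simp [ExpKernelCalculus.tr]

/-- [folklore] **CYCLICITY (right-loc, right-loc)**: both factors right-localised (at possibly different points and rates). -/
theorem tr_comp_comm_rl_rl (hK : ∀ x y a b, |K x y a b| ≤ Kp * Real.exp (-δ₁ * l1 (y - q))) (hδ₁ : 0 < δ₁) (hKp : 0 ≤ Kp)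
    (hL : ∀ x y a b, |L x y a b| ≤ Kl * Real.exp (-δ₂ * l1 (y - q'))) (hδ₂ : 0 < δ₂) (hKl : 0 ≤ Kl) :
    tr (comp K L) = tr (comp L K) := by
  refine tr_comp_comm_of_bound ⟨fun x => Kl * Real.exp (-δ₂ * l1 (x - q')), fun y => Kp * Real.exp (-δ₁ * l1 (y - q)),
    (summable_exp_shift' hδ₂ q').mul_left _, (summable_exp_shift' hδ₁ q).mul_left _, fun x => by positivity, fun y => by positivity,
    fun x y a f => ?_⟩
  rw [abs_mul]
  calc |K x y a f| * |L y x f a| ≤ (Kp * Real.exp (-δ₁ * l1 (y - q))) * (Kl * Real.exp (-δ₂ * l1 (x - q'))) :=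
        mul_le_mul (hK x y a f) (hL y x f a) (abs_nonneg _) (by positivity)
    _ = Kl * Real.exp (-δ₂ * l1 (x - q')) * (Kp * Real.exp (-δ₁ * l1 (y - q))) := by ring

/-- [folklore] cyclicity for two composites (Bdd∘Loc, Bdd∘Loc): `tr ((A∘Y)∘(A′∘Z)) = tr ((A′∘Z)∘(A∘Y))`. -/
theorem tr_comp_comm_bddloc_bddloc {A A' Y Z : MKer D F} {C C' : ℝ} (hA : Bdd A C) (hY : Loc Y) (hA' : Bdd A' C') (hZ : Loc Z) :
    tr (comp (comp A Y) (comp A' Z)) = tr (comp (comp A' Z) (comp A Y)) := by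
  obtain ⟨q, Kp, δ₁, hδ₁, hKp, h⟩ := rl_comp_bdd_loc hA hY
  obtain ⟨q', Kl, δ₂, hδ₂, hKl, h'⟩ := rl_comp_bdd_loc hA' hZ
  exact tr_comp_comm_rl_rl h hδ₁ hKp h' hδ₂ hKl

end Trace

/-! ## §5 Additivity at a bounded leg -/

section Additive

variable {A K L M : MKer D F} {C : ℝ}

/-- [folklore] `A ∘ (K + L) = A ∘ K + A ∘ L` given slice summability. -/
theorem comp_add_right' (hK : ∀ x z a b, Summable fun y : Fin D → ℤ => ∑ f, A x y a f * K y z f b)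
    (hL : ∀ x z a b, Summable fun y : Fin D → ℤ => ∑ f, A x y a f * L y z f b) : comp A (K + L) = comp A K + comp A L := by
  funext x z a b
  show (∑' y, ∑ f, A x y a f * (K + L) y z f b) = (∑' y, ∑ f, A x y a f * K y z f b) + ∑' y, ∑ f, A x y a f * L y z f b
  rw [← (hK x z a b).tsum_add (hL x z a b)]
  refine tsum_congr fun y => ?_
  rw [← Finset.sum_add_distrib]
  refine Finset.sum_congr rfl fun f _ => ?_
  simp only [Pi.add_apply]
  ring

/-- [folklore] `(K + L) ∘ M = K ∘ M + L ∘ M` given slice summability. -/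
theorem comp_add_left' (hK : ∀ x z a b, Summable fun y : Fin D → ℤ => ∑ f, K x y a f * M y z f b)
    (hL : ∀ x z a b, Summable fun y : Fin D → ℤ => ∑ f, L x y a f * M y z f b) : comp (K + L) M = comp K M + comp L M := by
  funext x z a b
  show (∑' y, ∑ f, (K + L) x y a f * M y z f b) = (∑' y, ∑ f, K x y a f * M y z f b) + ∑' y, ∑ f, L x y a f * M y z f b
  rw [← (hK x z a b).tsum_add (hL x z a b)]
  refine tsum_congr fun y => ?_
  rw [← Finset.sum_add_distrib]
  refine Finset.sum_congr rfl fun f _ => ?_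
  simp only [Pi.add_apply]
  ring

/-- [folklore] `tr (K + L) = tr K + tr L` given summability of the two trace series. -/
theorem tr_add' (hK : Summable fun x : Fin D → ℤ => ∑ a, K x x a a) (hL : Summable fun x : Fin D → ℤ => ∑ a, L x x a a) :
    tr (K + L) = tr K + tr L := by
  show (∑' x, ∑ a, (K + L) x x a a) = (∑' x, ∑ a, K x x a a) + ∑' x, ∑ a, L x x a a
  rw [← hK.tsum_add hL]
  refine tsum_congr fun x => ?_
  rw [← Finset.sum_add_distrib]
  rfl

/-- [folklore] **ADDITIVITY OF THE TADPOLE IN THE VERTEX, BOUNDED LEG**. -/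
theorem tadpole_add_bdd {W₁ W₂ : MKer D F} (hA : Bdd A C) (h₁ : Loc W₁) (h₂ : Loc W₂) :
    tadpole A (W₁ + W₂) = tadpole A W₁ + tadpole A W₂ := by
  unfold ExpKernelCalculus.tadpole
  rw [comp_add_right' (slices_bdd_loc hA h₁) (slices_bdd_loc hA h₂), tr_add' (summable_tr_bdd_loc hA h₁) (summable_tr_bdd_loc hA h₂)]

/-- [folklore] subtractivity of the tadpole in the vertex, bounded leg. -/
theorem tadpole_sub_bdd {W₁ W₂ : MKer D F} (hA : Bdd A C) (h₁ : Loc W₁) (h₂ : Loc W₂) :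
    tadpole A (W₁ - W₂) = tadpole A W₁ - tadpole A W₂ := by
  unfold ExpKernelCalculus.tadpole
  rw [comp_sub_right (slices_bdd_loc hA h₁) (slices_bdd_loc hA h₂), tr_sub (summable_tr_bdd_loc hA h₁) (summable_tr_bdd_loc hA h₂)]

/-- [folklore] **ADDITIVITY OF THE BUBBLE IN THE FIRST VERTEX, BOUNDED LEG** (the composites `A∘V` are right-localised). -/
theorem bubble_add_left_bdd {V₁ V₂ Z : MKer D F} (hA : Bdd A C) (h₁ : Loc V₁) (h₂ : Loc V₂) (hZ : Loc Z) :
    bubble A (V₁ + V₂) Z = bubble A V₁ Z + bubble A V₂ Z := by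
  obtain ⟨B, hAZ⟩ := bdd_comp_bdd_loc hA hZ
  obtain ⟨q₁, K₁, δ₁, hδ₁, _, r₁⟩ := rl_comp_bdd_loc hA h₁
  obtain ⟨q₂, K₂, δ₂, hδ₂, _, r₂⟩ := rl_comp_bdd_loc hA h₂
  obtain ⟨q, Kz, δ, hδ, _, rz⟩ := rl_comp_bdd_loc hA hZ
  unfold ExpKernelCalculus.bubble
  rw [comp_add_right' (slices_bdd_loc hA h₁) (slices_bdd_loc hA h₂), comp_add_left' (slices_rl_bdd r₁ hAZ hδ₁) (slices_rl_bdd r₂ hAZ hδ₂),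
    tr_add' (summable_trTerm_rl (abs_comp_le_of_rightLoc_rates r₁ hδ₁ rz hδ) (lt_min hδ₁ hδ))
      (summable_trTerm_rl (abs_comp_le_of_rightLoc_rates r₂ hδ₂ rz hδ) (lt_min hδ₂ hδ))]

/-- [folklore] **ADDITIVITY OF THE BUBBLE IN THE SECOND VERTEX, BOUNDED LEG**. -/
theorem bubble_add_right_bdd {Y Z₁ Z₂ : MKer D F} (hA : Bdd A C) (hY : Loc Y) (h₁ : Loc Z₁) (h₂ : Loc Z₂) :
    bubble A Y (Z₁ + Z₂) = bubble A Y Z₁ + bubble A Y Z₂ := by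
  obtain ⟨B₁, hAZ₁⟩ := bdd_comp_bdd_loc hA h₁
  obtain ⟨B₂, hAZ₂⟩ := bdd_comp_bdd_loc hA h₂
  obtain ⟨qy, Ky, δy, hδy, _, ry⟩ := rl_comp_bdd_loc hA hY
  obtain ⟨q₁, K₁, δ₁, hδ₁, _, r₁⟩ := rl_comp_bdd_loc hA h₁
  obtain ⟨q₂, K₂, δ₂, hδ₂, _, r₂⟩ := rl_comp_bdd_loc hA h₂
  unfold ExpKernelCalculus.bubble
  rw [comp_add_right' (slices_bdd_loc hA h₁) (slices_bdd_loc hA h₂), comp_add_right' (slices_rl_bdd ry hAZ₁ hδy) (slices_rl_bdd ry hAZ₂ hδy),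
    tr_add' (summable_trTerm_rl (abs_comp_le_of_rightLoc_rates ry hδy r₁ hδ₁) (lt_min hδy hδ₁))
      (summable_trTerm_rl (abs_comp_le_of_rightLoc_rates ry hδy r₂ hδ₂) (lt_min hδy hδ₂))]

end Additive

end Summit.QuantumFields.BalabanUV.Beta.FP.ChartConjugationBoundedBricks

end
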